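import Literature.Computability.AlgebraicComplexity.InterfaceTensors
import HarnessLib

/-!
# A level-1 `ε`-interface tensor degenerates to a matrix multiplication tensor
(Vassilevska Williams–Xu–Xu–Zhou 2024, §4.1: "Finally, we show that each level-1 `ε₁`-interface tensor
can be easily degenerated into a matrix multiplication tensor") — proved

Topic `Literature/Computability/AlgebraicComplexity`.  The framework of Vassilevska Williams–Xu–Xu–Zhou,
*New bounds for matrix multiplication: from alpha to omega* (SODA 2024, arXiv:2307.07970, §4.1 and the
algorithm `alg:framework` of §8) ends when the constituent stages have reached level `1`: a level-1
interface tensor has parameter list `{(n_t, i_t, j_t, k_t, γ)}` with `i_t + j_t + k_t = 2` (chunks of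
one position, `CW_q = ∑_{i+j+k=2} T_{i,j,k}`), and complete split distributions at level `1` carry no
information (a chunk shape of one position is its level).  Such a tensor is the block
`CW_q^{⊗n}|_{X_{w₁} × Y_{w₂} × Z_{w₃}}` of the label word `w = (i_{τu}, j_{τu}, k_{τu})_u`, i.e. the tensor
product over the positions of the components `T_{0,1,1} ≃ ⟨1,1,q⟩`, `T_{1,0,1}`, `T_{1,1,0}`, `T_{2,0,0} ≃ ⟨1,1,1⟩`,
… of `CW_q` (BCS §15.8), hence (a relabelling of) the matrix multiplication tensor
`⟨∏_u k(w_u), ∏_u m(w_u), ∏_u n(w_u)⟩`.  This file PROVES the degeneration claimed in §4.1 for the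
tree's `interfaceTensor` at chunk size `c = 1`:

* `constShapeSeq_mem_admissibleSeqs` — at `c = 1` the constant-level sequence is admissible as soon
  as the target split distributions are within `ε` of the Dirac masses at the level shapes (the only
  sensible level-1 data; for the Diracs themselves every `ε ≥ 0` works);
* `vxxz2024_levelOne_degeneration` — **`𝒯_{τ,L,ε} ≥ ⟨∏_u cwFmtK(w_u), ∏_u cwFmtM(w_u), ∏_u cwFmtN(w_u)⟩`**,
  via the laser index maps of `LaserMethodRestriction.lean` / `LaserMethodBigCW.lean`
  (`matMulDirectSum_eq_kroneckerPow_laserIndex`, `bigCwTensor_component`): the matrix tensor is the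
  pull-back of the interface tensor along injective index maps landing in the kept blocks;
* `prod_cwFmtK_eq_pow` (and `M`, `N`) — the three dimensions are `q^{#{u | w_u = (1,1,0)}}`,
  `q^{#{u | w_u = (0,1,1)}}`, `q^{#{u | w_u = (1,0,1)}}`.

Everything is proved; the definitions are the label word and the constant shape sequence; no named facts.

## References

* V. Vassilevska Williams, Y. Xu, Z. Xu, R. Zhou, *New bounds for matrix multiplication: from alpha
  to omega*, SODA 2024, arXiv:2307.07970 (held: `paper:arxiv-2307.07970`), §4.1 (last sentence of the
  framework) and §8 (`alg:framework`). [VassilevskaWilliamsXuXuZhou2024]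
* P. Bürgisser, M. Clausen, M. A. Shokrollahi, *Algebraic Complexity Theory*, Springer 1997, §15.8
  (components of `CW_q`, p. 383). [BurgisserClausenShokrollahi1997]
-/

noncomputable section

open scoped BigOperators
open Finset

namespace Literature.Computability.AlgebraicComplexity

open Literature.Barriers.MatrixMultiplication (bigCwTensor)

universe u

/-! ## Level-1 data: the label word and the constant shape sequences -/

section Data

variable {n s : ℕ} (τ : Fin n → Fin s) (L : Fin s → InterfaceTerm 1)

/-- **The label word of a level-1 parameter list**: position `u` carries the component
`(i_{τu}, j_{τu}, k_{τu})` of `CW_q`. [cite: VassilevskaWilliamsXuXuZhou2024, §4.1 (level-1 interface tensors)] -/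
def levelOneLabel (hL : ∀ t, (L t).i + (L t).j + (L t).k = 2) (u : Fin n) : Fin 3 × Fin 3 × Fin 3 :=
  (⟨(L (τ u)).i, by have := hL (τ u); omega⟩, ⟨(L (τ u)).j, by have := hL (τ u); omega⟩,
    ⟨(L (τ u)).k, by have := hL (τ u); omega⟩)

/-- The label word lies in the support `{i + j + k = 2}` of `CW_q`. [cite: VassilevskaWilliamsXuXuZhou2024, §4.1] -/
theorem levelOneLabel_mem (hL : ∀ t, (L t).i + (L t).j + (L t).k = 2) (u : Fin n) :
    levelOneLabel τ L hL u ∈ cwSupport₃ := by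
  rw [mem_cwSupport₃]
  simp only [levelOneLabel]
  exact hL (τ u)

/-- **The constant shape sequence of a level word**: at `c = 1` the chunk shape of level `d` is the
one-position shape `d`. [cite: VassilevskaWilliamsXuXuZhou2024, §4.1] -/
def constShapeSeq (deg : Fin n → Fin 3) : Fin n → Fin 1 → Fin 3 := fun u _ => deg u

/-- The level of a one-position shape is its value. [folklore] -/
theorem patternLevel_fin_one (σ : Fin 1 → Fin 3) : patternLevel σ = (σ 0 : ℕ) := by
  simp [patternLevel]

/-- A one-position shape is determined by its value at `0`. [folklore] -/
theorem eq_const_of_fin_one (σ : Fin 1 → Fin 3) : σ = fun _ => σ 0 := by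
  funext p; rw [Subsingleton.elim p 0]

/-- **At `c = 1` the constant shape sequence is admissible** for targets within `ε` of the Dirac
masses at the level shapes (levels right; the split distribution of a constant sequence on a term is
the Dirac mass). [cite: VassilevskaWilliamsXuXuZhou2024, §4.1 and Def. 4.1] -/
theorem constShapeSeq_mem_admissibleSeqs (deg : Fin s → Fin 3) (γ : Fin s → (Fin 1 → Fin 3) → ℝ) (ε : ℝ)
    (hγ : ∀ t σ, |(if σ = fun _ => deg t then (1 : ℝ) else 0) - γ t σ| ≤ ε) :
    constShapeSeq (fun u => deg (τ u)) ∈ admissibleSeqs τ (fun t => (deg t : ℕ)) γ ε := by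
  rw [mem_admissibleSeqs]
  refine ⟨fun u => by simp [constShapeSeq, patternLevel_fin_one], fun t hne σ => ?_⟩
  have hsplit : completeSplitOn (constShapeSeq fun u => deg (τ u)) (univ.filter fun u => τ u = t) σ =
      if σ = fun _ => deg t then 1 else 0 := by
    rw [completeSplitOn_apply]
    have hcard : ((univ.filter fun u => τ u = t).card : ℝ) ≠ 0 := by exact_mod_cast hne.card_pos.ne'
    split_ifs with hσ
    · have hall : (univ.filter fun u => τ u = t).filter (fun u => constShapeSeq (fun u => deg (τ u)) u = σ) =
          univ.filter fun u => τ u = t := by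
        refine filter_true_of_mem fun u hu => ?_
        rw [mem_filter] at hu
        rw [hσ]; funext p; simp [constShapeSeq, hu.2]
      rw [hall, div_self hcard]
    · rw [div_eq_zero_iff]; left
      norm_cast
      rw [card_eq_zero, filter_eq_empty_iff]
      intro u hu h
      rw [mem_filter] at hu
      apply hσ
      rw [← h]; funext p; simp [constShapeSeq, hu.2]
  rw [hsplit]
  exact hγ t σ

end Data

/-! ## The degeneration to the matrix multiplication tensor -/

section Degeneration

variable (K : Type u) [CommSemiring K] (q : ℕ) {n s : ℕ} (τ : Fin n → Fin s) (L : Fin s → InterfaceTerm 1)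

/-- The laser index maps keep the levels (images lie in the block of the label). [cite: BurgisserClausenShokrollahi1997, §15.8 (p. 383)] -/
theorem cwLevel₃_laser (sv : Fin 3 × Fin 3 × Fin 3) (hs : sv ∈ cwSupport₃) :
    (∀ u : Fin (cwFmtK q sv) × Fin (cwFmtN q sv), cwLevel₃ (cwEI q sv u) = sv.1) ∧
    (∀ v : Fin (cwFmtK q sv) × Fin (cwFmtM q sv), cwLevel₃ (cwEJ q sv v) = sv.2.1) ∧
    (∀ w : Fin (cwFmtM q sv) × Fin (cwFmtN q sv), cwLevel₃ (cwEL q sv w) = sv.2.2) := by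
  rw [mem_cwSupport₃_iff] at hs
  refine ⟨fun u => cwLevel₃_cwIdxOfLevel _ _ ?_, fun v => cwLevel₃_cwIdxOfLevel _ _ ?_,
    fun w => cwLevel₃_cwIdxOfLevel _ _ ?_⟩
  · have h1 := u.1.isLt; have h2 := u.2.isLt
    rcases hs with rfl | rfl | rfl | rfl | rfl | rfl <;>
      simp [cwFmtK, cwFmtN] at h1 h2 ⊢
  · have h1 := v.1.isLt; have h2 := v.2.isLt
    rcases hs with rfl | rfl | rfl | rfl | rfl | rfl <;>
      simp [cwFmtK, cwFmtM] at h1 h2 ⊢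
  · have h1 := w.1.isLt; have h2 := w.2.isLt
    rcases hs with rfl | rfl | rfl | rfl | rfl | rfl <;>
      simp [cwFmtM, cwFmtN] at h1 h2 ⊢

/-- **VXXZ §4.1, the last step of the framework: a level-1 `ε`-interface tensor degenerates to a matrix
multiplication tensor.**  For chunk size `c = 1`, terms with `i_t + j_t + k_t = 2` and target split
distributions within `ε` of the Dirac masses at the level shapes, with `w` the label word
(`levelOneLabel`),
`𝒯_{τ,L,ε} ≥ ⟨∏_u cwFmtK q (w u), ∏_u cwFmtM q (w u), ∏_u cwFmtN q (w u)⟩`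
(`= ⟨q^{#{w_u=(1,1,0)}}, q^{#{w_u=(0,1,1)}}, q^{#{w_u=(1,0,1)}}⟩`, `prod_cwFmtK_eq_pow`): the matrix
tensor is the pull-back of `𝒯` along the (injective) laser index maps of the block of `w`.
[cite: VassilevskaWilliamsXuXuZhou2024, §4.1 ("each level-1 ε₁-interface tensor can be easily degenerated into a matrix multiplication tensor")] -/
theorem vxxz2024_levelOne_degeneration (hL : ∀ t, (L t).i + (L t).j + (L t).k = 2) (ε : ℝ)
    (hγX : ∀ t σ, |(if σ = fun _ => (⟨(L t).i, by have := hL t; omega⟩ : Fin 3) then (1 : ℝ) else 0) - (L t).γX σ| ≤ ε)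
    (hγY : ∀ t σ, |(if σ = fun _ => (⟨(L t).j, by have := hL t; omega⟩ : Fin 3) then (1 : ℝ) else 0) - (L t).γY σ| ≤ ε)
    (hγZ : ∀ t σ, |(if σ = fun _ => (⟨(L t).k, by have := hL t; omega⟩ : Fin 3) then (1 : ℝ) else 0) - (L t).γZ σ| ≤ ε) :
    TensorRestrictsTo (interfaceTensor K q τ L ε)
      (matMulTensor K (∏ u, cwFmtK q (levelOneLabel τ L hL u)) (∏ u, cwFmtM q (levelOneLabel τ L hL u))
        (∏ u, cwFmtN q (levelOneLabel τ L hL u))) := by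
  classical
  set w := levelOneLabel τ L hL with hw
  -- the one-element diagonal and the laser identity
  let d : Fin 1 → (Fin n → Fin 3) × (Fin n → Fin 3) × (Fin n → Fin 3) :=
    fun _ => (fun u => (w u).1, fun u => (w u).2.1, fun u => (w u).2.2)
  have hlab : ∀ i, labelSeq (d i) = w := by intro i; funext u; rfl
  have hdS : ∀ i ρ, labelSeq (d i) ρ ∈ cwSupport₃ := by
    intro i ρ; rw [hlab i]; exact levelOneLabel_mem τ L hL ρ
  have hfree : ∀ i i' i'' : Fin 1, (∀ ρ, ((d i).1 ρ, (d i').2.1 ρ, (d i'').2.2 ρ) ∈ cwSupport₃) → i = i' ∧ i' = i'' :=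
    fun i i' i'' _ => ⟨Subsingleton.elim _ _, Subsingleton.elim _ _⟩
  have hS : ∀ a b c, bigCwTensor K q a b c ≠ 0 → (cwLevel₃ a, cwLevel₃ b, cwLevel₃ c) ∈ cwSupport₃ :=
    fun a b c h => cwLevel₃_mem_support K h
  have key := fun a b c => matMulDirectSum_eq_kroneckerPow_laserIndex (bigCwTensor K q) cwLevel₃ cwLevel₃ cwLevel₃
    cwSupport₃ hS (cwFmtK q) (cwFmtM q) (cwFmtN q) (cwEI q) (cwEJ q) (cwEL q)
    (fun sv hs => (cwLevel₃_laser q sv hs).1) (fun sv hs => (cwLevel₃_laser q sv hs).2.1)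
    (fun sv hs => (cwLevel₃_laser q sv hs).2.2) (fun sv hs => bigCwTensor_component K q sv hs) d hdS hfree a b c
  -- the index maps into the variables of `𝒯`
  let fX : Fin (∏ u, cwFmtK q (w u)) × Fin (∏ u, cwFmtN q (w u)) → (Fin n → Fin 1 → Fin (q + 2)) :=
    fun a u _ => laserIndex₁ (cwFmtK q) (cwFmtN q) (cwEI q) w a u
  let fY : Fin (∏ u, cwFmtK q (w u)) × Fin (∏ u, cwFmtM q (w u)) → (Fin n → Fin 1 → Fin (q + 2)) :=
    fun b u _ => laserIndex₂ (cwFmtK q) (cwFmtM q) (cwEJ q) w b u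
  let fZ : Fin (∏ u, cwFmtM q (w u)) × Fin (∏ u, cwFmtN q (w u)) → (Fin n → Fin 1 → Fin (q + 2)) :=
    fun c u _ => laserIndex₃ (cwFmtM q) (cwFmtN q) (cwEL q) w c u
  -- their level sequences are the constant shape sequences, which are admissible
  have hXlev : ∀ a, levelSeq (fX a) = constShapeSeq fun u => (w u).1 := by
    intro a; funext u p
    simp only [levelSeq_apply, constShapeSeq, fX, laserIndex₁_apply]
    exact (cwLevel₃_laser q (w u) (levelOneLabel_mem τ L hL u)).1 _
  have hYlev : ∀ b, levelSeq (fY b) = constShapeSeq fun u => (w u).2.1 := by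
    intro b; funext u p
    simp only [levelSeq_apply, constShapeSeq, fY, laserIndex₂_apply]
    exact (cwLevel₃_laser q (w u) (levelOneLabel_mem τ L hL u)).2.1 _
  have hZlev : ∀ c, levelSeq (fZ c) = constShapeSeq fun u => (w u).2.2 := by
    intro c; funext u p
    simp only [levelSeq_apply, constShapeSeq, fZ, laserIndex₃_apply]
    exact (cwLevel₃_laser q (w u) (levelOneLabel_mem τ L hL u)).2.2 _
  have hXmem : ∀ a, levelSeq (fX a) ∈ levelBlocksX τ L ε := by
    intro a; rw [hXlev]
    have h := constShapeSeq_mem_admissibleSeqs τ (fun t => (⟨(L t).i, by have := hL t; omega⟩ : Fin 3))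
      (fun t => (L t).γX) ε hγX
    exact h
  have hYmem : ∀ b, levelSeq (fY b) ∈ levelBlocksY τ L ε := by
    intro b; rw [hYlev]
    have h := constShapeSeq_mem_admissibleSeqs τ (fun t => (⟨(L t).j, by have := hL t; omega⟩ : Fin 3))
      (fun t => (L t).γY) ε hγY
    exact h
  have hZmem : ∀ c, levelSeq (fZ c) ∈ levelBlocksZ τ L ε := by
    intro c; rw [hZlev]
    have h := constShapeSeq_mem_admissibleSeqs τ (fun t => (⟨(L t).k, by have := hL t; omega⟩ : Fin 3))
      (fun t => (L t).γZ) ε hγZ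
    exact h
  -- the matrix tensor is the pull-back of `𝒯`
  have e : matMulTensor K (∏ u, cwFmtK q (w u)) (∏ u, cwFmtM q (w u)) (∏ u, cwFmtN q (w u)) =
      fun a b c => interfaceTensor K q τ L ε (fX a) (fY b) (fZ c) := by
    funext a b c
    rw [interfaceTensor_apply, if_pos ⟨hXmem a, hYmem b, hZmem c⟩]
    have hk := key ⟨0, a⟩ ⟨0, b⟩ ⟨0, c⟩
    rw [kroneckerPow_apply] at hk
    have lhs : matMulTensor K (∏ u, cwFmtK q (w u)) (∏ u, cwFmtM q (w u)) (∏ u, cwFmtN q (w u)) a b c =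
        matMulDirectSum K (fun i => ∏ ρ, cwFmtK q (labelSeq (d i) ρ)) (fun i => ∏ ρ, cwFmtM q (labelSeq (d i) ρ))
          (fun i => ∏ ρ, cwFmtN q (labelSeq (d i) ρ)) ⟨0, a⟩ ⟨0, b⟩ ⟨0, c⟩ := by
      simp only [matMulTensor, matMulDirectSum, true_and, Fin.ext_iff]
    rw [lhs, hk]
    refine prod_congr rfl fun u _ => ?_
    rw [Fin.prod_univ_one]
  rw [e]
  exact TensorRestrictsTo.comap _ _ _ _

/-- The first dimension: `∏_u cwFmtK q (w u) = q^{#{u | w_u = (1,1,0)}}`. [cite: BurgisserClausenShokrollahi1997, §15.8 (t(1,1,0) ≃ ⟨1,q,1⟩)] -/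
theorem prod_cwFmtK_eq_pow (w : Fin n → Fin 3 × Fin 3 × Fin 3) :
    ∏ u, cwFmtK q (w u) = q ^ (univ.filter fun u => w u = (1, 1, 0)).card := by
  simp only [cwFmtK, prod_ite, prod_const_one, mul_one, prod_const]

/-- The second dimension: `∏_u cwFmtM q (w u) = q^{#{u | w_u = (0,1,1)}}`. [cite: BurgisserClausenShokrollahi1997, §15.8] -/
theorem prod_cwFmtM_eq_pow (w : Fin n → Fin 3 × Fin 3 × Fin 3) :
    ∏ u, cwFmtM q (w u) = q ^ (univ.filter fun u => w u = (0, 1, 1)).card := by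
  simp only [cwFmtM, prod_ite, prod_const_one, mul_one, prod_const]

/-- The third dimension: `∏_u cwFmtN q (w u) = q^{#{u | w_u = (1,0,1)}}`. [cite: BurgisserClausenShokrollahi1997, §15.8] -/
theorem prod_cwFmtN_eq_pow (w : Fin n → Fin 3 × Fin 3 × Fin 3) :
    ∏ u, cwFmtN q (w u) = q ^ (univ.filter fun u => w u = (1, 0, 1)).card := by
  simp only [cwFmtN, prod_ite, prod_const_one, mul_one, prod_const]

end Degeneration

end Literature.Computability.AlgebraicComplexity
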